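import Summits.ABC.IUTFork.Cor312RegimeVerbatimPrVolSingle
import HarnessLib

/-!
# [IUTchIII] Cor. 3.12 — a POSITIVE instance of the typed Corollary AT GENUINE SPLIT DATA: if every bad prime `p` is odd,
# unramified in `F`, carries ONE bad place `v_p` of bad mass `β_p` with `PN_i((i+1)²·β_p^{i+1}) ≤ 1`, then the typed
# Statement HOLDS at `Real.settingPrVolSharp` for the sharp pilot ideles — by (Ind1)-inflation, NOT by the disputed step

PROOF-ONLY support piece of the abc-iut cell (Cor. 3.12 cone, D-0067; seat abc-iut-w4-d107, gen 4; part 10, the named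
corollary of part 9 `Cor312RegimeVerbatimPrVolSingle`). TAKES NO SIDE on [IUTchIII] Cor. 3.12; theorems only, 0 `def`s, no
new `Prop` fact. The per-prime SPLIT CRITERION `PN_i((i+1)²·β_p^{i+1}) ≤ 1` (`PN` = procession normalisation over
`j = i+1 ∈ {1,…,ℓ⋇}`; `β_p = n_{v_p}/[F:ℚ]` the bad mass, Dupuy–Hilado §3.6) makes the slot-symmetrised Θ-mass
`A = Σ_p β_p·D_p·log p·PN_i((i+1)²β_p^{i+1})` at most the `q`-mass `B = Σ_p β_p·D_p·log p`, whence the typed Statement by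
part 9. Examples: `ℓ⋇ = 2` (`ℓ = 5`): criterion `(β² + 4β³)/2 ≤ 1`, i.e. `β ≤ 0.53…` — a prime split into two places of
equal degree with one of them bad (`β = 1/2`) qualifies at EVERY depth `D_p`. At bad mass one (`β_p = 1`) the criterion
fails (`PN_i((i+1)²) = κ ≥ 5/2`) and part 4 / part 9 give `¬ Statement` for deep `q`. HONEST SCOPE: (Ind2) as typed at the
real setting (`Real.ismDH`); sharp (Ind3) reading; trivial archimedean container; free ideles (realising ones exist iff
`2l ∣ ord_v(q_v)`, plan C-R16); the instance is INFLATION-DOMINATED — the typed (Ind1)-hull raises the Θ-volume to the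
unit box at every mixed packet — and says nothing about print's intended content or about the disputed (xi-e)/(xi-f)
inference; nothing here asserts or denies [IUTchIII] Cor. 3.12 for initial Θ-data. typed ≠ proved; instantiated ≠
endorsed. [claim: Mochizuki2012, status: disputed] [cite: DupuyHilado2025, §3.4, §3.6, §4.7] [cite: ScholzeStix2018, §2.2 pp. 9–10]
-/

noncomputable section

open Set Function NumberField IsDedekindDomain
open scoped Pointwise

namespace Summit.ABC

namespace IUTFork

namespace Thm311

namespace Real

open Cor312 Cor312.Setting Cor312Vol Literature.IUT.LogThetaLattice Literature.IUT.LogVolume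

variable {F : Type} [Field F] [NumberField F] (X : PilotData F) {logv : PadicLogs F} (hlog : LogvAnalytic logv)

/-- **PN-linearity and the split criterion**: if `PN_i((i+1)²·β_p^{i+1}) ≤ 1` and `0 ≤ β_p`, `0 ≤ w_p` for every `p ∈ U`,
then `PN_i Σ_{p∈U} β_p^{i+2}·(i+1)²·w_p ≤ Σ_{p∈U} β_p·w_p`. [folklore] -/
theorem processionNormalized_sum_pow_sq_le {lstar : ℕ} (hl : 0 < lstar) (U : Finset Nat.Primes) (β w : Nat.Primes → ℝ)
    (hβ : ∀ pp ∈ U, 0 ≤ β pp) (hw : ∀ pp ∈ U, 0 ≤ w pp)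
    (hsplit : ∀ pp ∈ U,
      processionNormalized (fun i : Fin lstar => ((((i : ℕ) + 1 : ℕ)) : ℝ) ^ 2 * β pp ^ ((i : ℕ) + 1)) ≤ 1) :
    processionNormalized (fun i : Fin lstar => ∑ pp ∈ U,
        β pp ^ ((i : ℕ) + 2) * (((((i : ℕ) + 1 : ℕ)) : ℝ) ^ 2 * w pp)) ≤ ∑ pp ∈ U, β pp * w pp := by
  have hl0 : (0 : ℝ) < lstar := by exact_mod_cast hl
  -- PN of a sum over `U` is the sum over `U` of the PN's (linearity), and each summand factors `β_p·w_p`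
  have hlin : processionNormalized (fun i : Fin lstar => ∑ pp ∈ U,
      β pp ^ ((i : ℕ) + 2) * (((((i : ℕ) + 1 : ℕ)) : ℝ) ^ 2 * w pp)) =
      ∑ pp ∈ U, β pp * w pp *
        processionNormalized (fun i : Fin lstar => ((((i : ℕ) + 1 : ℕ)) : ℝ) ^ 2 * β pp ^ ((i : ℕ) + 1)) := by
    unfold processionNormalized
    rw [Finset.sum_comm, Finset.sum_div]
    refine Finset.sum_congr rfl fun pp _ => ?_
    rw [mul_div_assoc']
    congr 1
    rw [Finset.mul_sum]
    exact Finset.sum_congr rfl fun i _ => by ring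
  rw [hlin]
  refine Finset.sum_le_sum fun pp hpp => ?_
  calc β pp * w pp * processionNormalized (fun i : Fin lstar => ((((i : ℕ) + 1 : ℕ)) : ℝ) ^ 2 * β pp ^ ((i : ℕ) + 1))
      ≤ β pp * w pp * 1 :=
        mul_le_mul_of_nonneg_left (hsplit pp hpp) (mul_nonneg (hβ pp hpp) (hw pp hpp))
    _ = β pp * w pp := mul_one _

open scoped Classical in
/-- **THE TYPED [IUTchIII] COR. 3.12 HOLDS AT GENUINE SPLIT DATA** (module docstring): for every context and every
sharp pilot ideles at `Real.settingPrVolSharp` supported at ONE bad place `v_p` over each prime `p` of a finite set `U`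
of ODD primes UNRAMIFIED in `F` (depths `D_p`, `‖t_{q,v}‖ = ‖p^{D_p[v = v_p]}‖`, `‖t_{Θ,i+1,v}‖ = ‖p^{(i+1)²D_p[v = v_p]}‖`),
if `PN_i((i+1)²·β_p^{i+1}) ≤ 1` at every `p ∈ U` (`β_p = Pr(v_p)` the bad mass), then `Statement` — at EVERY depth.
Inflation-dominated; no side taken. [claim: Mochizuki2012, status: disputed] [cite: DupuyHilado2025, §3.6, §4.7] -/
theorem statement_settingPrVolSharp_of_split
    (M : Type) [Field M] [NumberField M]
    (archPk : ∀ (j : (thetaIndex X).Label) (vQ : (thetaIndex X).VQ), Set ((logShellsDH X logv).Packet j vQ))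
    (archSub : ∀ (j : (thetaIndex X).Label) (v : (thetaIndex X).V),
      Set ((logShellsDH X logv).Packet j ((thetaIndex X).over v)))
    (Ψ : ℤ → ∀ v : (thetaIndex X).V, v ∈ (thetaIndex X).Vbad → Set ((logShellsDH X logv).StarPacket v))
    (act : ℤ → ∀ v : (thetaIndex X).V, v ∈ (thetaIndex X).Vbad →
      (logShellsDH X logv).StarPacket v → Module.End ℚ ((logShellsDH X logv).StarPacket v))
    (Mmod : ℤ → ∀ j : (thetaIndex X).LabelStar, Set ((logShellsDH X logv).GlobalPacket j.1))
    (region : ℤ → ∀ j : (thetaIndex X).LabelStar, FinDivisor M → ∀ vQ : (thetaIndex X).VQ,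
      Set ((logShellsDH X logv).Packet j.1 vQ))
    (n : ℤ) {HT : Type} {LogLink : HT → HT → Type} {IsFull : ∀ {s t : HT}, LogLink s t → Prop}
    (lat : LGPGaussianLogThetaLattice LogLink IsFull)
    {Frd : Type} {IsoF : Frd → Frd → Type} {Ob : Frd → Type} {realify : Frd → Frd} {Strip : Type}
    {IsoS : Strip → Strip → Type} {Mv : ∀ v : (thetaIndex X).V, v ∈ (thetaIndex X).Vbad → Type}
    [∀ v h, Monoid (Mv v h)]
    (sig : GlobalLGPFrobenioidSignature (thetaIndex X).lstar (thetaIndex X).V (· ∈ (thetaIndex X).Vbad)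
      Frd IsoF Ob realify Strip IsoS Mv)
    (split : SplittingMonoids Mv) {ObΔ : Type} {N : ∀ v : (thetaIndex X).V, v ∈ (thetaIndex X).Vbad → Type}
    [∀ v h, Monoid (N v h)] (qData : QPilotData ObΔ N)
    (tq : ∀ (pp : Nat.Primes) (x : (thetaIndex X).Fibre (.inr pp)), haveI : Fact (pp : ℕ).Prime := ⟨pp.2⟩; kOf X pp.1 x)
    (t : ∀ (pp : Nat.Primes) (_ : Fin X.lstar) (x : (thetaIndex X).Fibre (.inr pp)),
      haveI : Fact (pp : ℕ).Prime := ⟨pp.2⟩; kOf X pp.1 x)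
    (ht0 : ∀ pp i x, t pp i x ≠ 0)
    (ht1 : ∀ (pp : Nat.Primes) (i : Fin X.lstar) (x : (thetaIndex X).Fibre (.inr pp)),
      haveI : Fact (pp : ℕ).Prime := ⟨pp.2⟩; placeOf X pp.1 x ∉ X.S → ‖t pp i x‖ = 1)
    (htq0 : ∀ pp x, tq pp x ≠ 0)
    (htq1 : ∀ (pp : Nat.Primes) (x : (thetaIndex X).Fibre (.inr pp)),
      haveI : Fact (pp : ℕ).Prime := ⟨pp.2⟩; placeOf X pp.1 x ∉ X.S → ‖tq pp x‖ = 1)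
    (U : Finset Nat.Primes)
    (hU : ∀ (pp : Nat.Primes) (x : (thetaIndex X).Fibre (.inr pp)),
      haveI : Fact (pp : ℕ).Prime := ⟨pp.2⟩; placeOf X pp.1 x ∈ X.S → pp ∈ U)
    (hU2 : ∀ pp ∈ U, 2 < (pp : ℕ)) (hUd : ∀ pp ∈ U, ¬ ((pp : ℕ) : ℤ) ∣ NumberField.discr F)
    (x₀ : ∀ pp : Nat.Primes, (thetaIndex X).Fibre (.inr pp)) (D : Nat.Primes → ℕ)
    (hm : ∀ (pp : Nat.Primes), pp ∈ U → ∀ (i : Fin (thetaIndex X).lstar) (x : (thetaIndex X).Fibre (.inr pp)),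
      haveI : Fact (pp : ℕ).Prime := ⟨pp.2⟩
      ‖t pp i x‖ = ‖((pp : ℕ) : ℚ_[pp]) ^ (if x = x₀ pp then ((((i : ℕ) + 1) ^ 2 * D pp : ℕ) : ℤ) else 0)‖)
    (hmq : ∀ (pp : Nat.Primes), pp ∈ U → ∀ (x : (thetaIndex X).Fibre (.inr pp)),
      haveI : Fact (pp : ℕ).Prime := ⟨pp.2⟩
      ‖tq pp x‖ = ‖((pp : ℕ) : ℚ_[pp]) ^ (if x = x₀ pp then ((D pp : ℕ) : ℤ) else 0)‖)
    (hsplit : ∀ pp ∈ U, haveI : Fact (pp : ℕ).Prime := ⟨pp.2⟩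
      processionNormalized (fun i : Fin (thetaIndex X).lstar =>
        ((((i : ℕ) + 1 : ℕ)) : ℝ) ^ 2 * weight F (placeOf X pp.1 (x₀ pp)) ^ ((i : ℕ) + 1)) ≤ 1) :
    (settingPrVolSharp X hlog M archPk archSub Ψ act Mmod region n lat sig split qData tq t htq0 htq1).Statement := by
  obtain ⟨C₂, -, hC⟩ := settingPrVolSharp_regime_dichotomy_single X hlog
  refine (hC M archPk archSub Ψ act Mmod region n HT LogLink IsFull lat Frd IsoF Ob realify Strip IsoS Mv inferInstance sig
    split ObΔ N inferInstance qData tq t ht0 ht1 htq0 htq1 U hU hU2 hUd x₀ D hm hmq).1 ?_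
  have hl : 0 < (thetaIndex X).lstar := lt_of_lt_of_le (by norm_num) (thetaIndex X).two_le_lstar
  have h := processionNormalized_sum_pow_sq_le hl U
    (fun pp => haveI : Fact (pp : ℕ).Prime := ⟨pp.2⟩; weight F (placeOf X pp.1 (x₀ pp)))
    (fun pp => (D pp : ℝ) * Real.log (pp : ℕ))
    (fun pp _ => by haveI : Fact (pp : ℕ).Prime := ⟨pp.2⟩; exact weight_nonneg F _)
    (fun pp _ => mul_nonneg (Nat.cast_nonneg _) (Real.log_nonneg (by exact_mod_cast pp.2.one_lt.le)))
    hsplit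
  refine le_trans (le_of_eq (congrArg processionNormalized (funext fun i => Finset.sum_congr rfl fun pp _ => ?_)))
    (h.trans (le_of_eq (Finset.sum_congr rfl fun pp _ => ?_)))
  · ring
  · ring

end Real

end Thm311

end IUTFork

end Summit.ABC

end
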